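import Mathlib
import Literature.Geometry.Symplectic.JHolomorphicMap
import Literature.Geometry.Manifold.LocalDiffeoOnOpen

/-!
# Stub `stub_anchorOfPencil` of line `Sketch` (skeleton v6) for crux `TameOrBrodyR4` (stmt-SmoothPoincare4-7826, route SullivanDual)

**The anchor map of a complete pencil.** A pencil of `J`-holomorphic planes in `ℝ⁴` is given as
an evaluation map `F : ℂ → ℂ → ℝ⁴` (`F b ξ` = the point with parameter `ξ` on the member asymptotic
to the coordinate line `{Q = b}`, `Q : ℝ⁴ →L[ℝ] ℂ` one complex coordinate) whose total map
`Φ (b, ξ) = F b ξ` is `C^∞`, bijective, with bijective differential everywhere, whose slices `F b`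
are flat-`J`-holomorphic, and whose far members `F b`, `|b| ≥ R`, fill exactly the lines `{Q = b}`.
We prove that `Φ` has a `C^∞` two-sided inverse `β` (global inverse function theorem on the open
set `univ`: `Literature.Geometry.Manifold.contDiffOn_invFunOn_of_forall_hasStrictFDerivAt_equiv`,
the strict derivatives coming from `ContDiffAt.hasStrictFDerivAt` and the bijective differentials
upgraded to continuous linear equivalences by `ContinuousLinearEquiv.ofBijective`); by the chain
rule `dβ ∘ dΦ = id` and `dΦ ∘ dβ = id`, so the anchor map `x ↦ (β x).1` is a submersion whose
kernel at `x = F b ξ` is `dΦ_{(b, ξ)} ({0} × ℂ) = range d(F b)_ξ`, the tangent plane of the member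
through `x`; this plane is `J x`-invariant because `d(F b)_ξ (i ζ) = J (F b ξ) (d(F b)_ξ ζ)`; the
anchor map is honest (`(β x).1 = Q x` where `|Q x| ≥ R`, as `x = F (Q x) ξ'`) and slab-confined
(`|(β x).1| < R` where `|Q x| < R`, as a member with `|b| ≥ R` lies in `{Q = b}`). Pure calculus
and linear algebra, no `J`-curve theory. Sources: J. M. Lee, *Introduction to Smooth Manifolds*,
2nd ed. (2013), Thm. 4.5 (inverse function theorem); M. Gromov, *Pseudo holomorphic curves in
symplectic manifolds*, Invent. Math. 82 (1985), §2.4.A (the pencils).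
-/

open scoped ContDiff Topology
open Filter Set Function Literature.Geometry.Symplectic

-- the registered namespace `Summit.SmoothPoincare4.SmoothPoincare4.…` repeats a component
set_option linter.dupNamespace false

noncomputable section

namespace Summit.SmoothPoincare4.SmoothPoincare4.Cruxes.TameOrBrodyR4.Sketch

/-- Local notation for the model space `ℝ⁴ = EuclideanSpace ℝ (Fin 4)`. -/
local notation "E4" => EuclideanSpace ℝ (Fin 4)

namespace AnchorOfPencil

variable {E G : Type*} [NormedAddCommGroup E] [NormedSpace ℝ E] [NormedAddCommGroup G]
  [NormedSpace ℝ G]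

/-- Chain rule for a left inverse: if `g (f x) = x` for all `x` with `f`, `g` differentiable, then
`dg_{f x} ∘ df_x = id`. -/
theorem fderiv_comp_fderiv_eq_id {f : E → G} {g : G → E} (hf : Differentiable ℝ f)
    (hg : Differentiable ℝ g) (h : ∀ x, g (f x) = x) (x : E) :
    (fderiv ℝ g (f x)).comp (fderiv ℝ f x) = ContinuousLinearMap.id ℝ E := by
  have hc : HasFDerivAt (g ∘ f) ((fderiv ℝ g (f x)).comp (fderiv ℝ f x)) x :=
    (hg (f x)).hasFDerivAt.comp x (hf x).hasFDerivAt
  have hid : g ∘ f = id := funext h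
  rw [hid] at hc
  exact hc.unique (hasFDerivAt_id x)

/-- **Global inverse function theorem.** A `C^∞` bijection between Banach spaces with bijective
differential everywhere has a `C^∞` two-sided inverse (the inverse is `C^∞` on the image `univ` of
the open set `univ` by `Literature.Geometry.Manifold.contDiffOn_invFunOn_of_forall_hasStrictFDerivAt_equiv`). -/
theorem exists_contDiff_inverse [CompleteSpace E] [CompleteSpace G] [Nonempty E] {f : E → G}
    (h1 : ContDiff ℝ ∞ f) (h2 : Bijective f) (h3 : ∀ p, Bijective (fderiv ℝ f p)) :
    ∃ g : G → E, ContDiff ℝ ∞ g ∧ (∀ p, g (f p) = p) ∧ ∀ x, f (g x) = x := by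
  have hd : ∀ p ∈ (univ : Set E), ∃ L : E ≃L[ℝ] G, HasStrictFDerivAt f (L : E →L[ℝ] G) p := by
    intro p _
    refine ⟨ContinuousLinearEquiv.ofBijective (fderiv ℝ f p)
      (LinearMap.ker_eq_bot.mpr (h3 p).1) (LinearMap.range_eq_top.mpr (h3 p).2), ?_⟩
    rw [ContinuousLinearEquiv.coe_ofBijective]
    exact h1.contDiffAt.hasStrictFDerivAt (by simp)
  have hg : ContDiffOn ℝ ∞ (invFunOn f univ) (f '' univ) :=
    Literature.Geometry.Manifold.contDiffOn_invFunOn_of_forall_hasStrictFDerivAt_equiv isOpen_univ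
      h1.contDiffOn (by simp) h2.1.injOn hd
  rw [image_univ_of_surjective h2.2, contDiffOn_univ] at hg
  exact ⟨invFunOn f univ, hg, fun p => h2.1.injOn.leftInvOn_invFunOn (mem_univ p),
    fun x => invFunOn_eq (by obtain ⟨a, ha⟩ := h2.2 x; exact ⟨a, mem_univ a, ha⟩)⟩

end AnchorOfPencil

/-- **Stub C2a (the anchor map of a complete pencil).** If the evaluation map `Φ (b, ξ) = F b ξ`
of a pencil is `C^∞`, bijective, with bijective differential everywhere, with flat-`J`-holomorphic
slices, and its far members `F b`, `|b| ≥ R`, map into and onto the lines `{Q = b}`, then `Φ` has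
a `C^∞` two-sided inverse `β`, the anchor map `x ↦ (β x).1` is a submersion whose kernel at `x` is
the tangent plane `range d(F (β x).1)_{(β x).2}` of the member through `x`, this kernel is
`J x`-invariant, and the anchor map is honest (`= Q` where `|Q| ≥ R`) and slab-confined
(`|(β x).1| < R` where `|Q x| < R`). -/
theorem stub_anchorOfPencil (J : E4 → E4 →L[ℝ] E4) (R : ℝ) (Q : E4 →L[ℝ] ℂ) (F : ℂ → ℂ → E4)
    (hF1 : ContDiff ℝ ∞ (fun p : ℂ × ℂ => F p.1 p.2))
    (hF2 : Function.Bijective (fun p : ℂ × ℂ => F p.1 p.2))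
    (hF3 : ∀ p : ℂ × ℂ, Function.Bijective (fderiv ℝ (fun p : ℂ × ℂ => F p.1 p.2) p))
    (hF4 : ∀ b, IsJHolomorphicFlat J (F b))
    (hF5 : ∀ b : ℂ, R ≤ ‖b‖ → ∀ ξ, Q (F b ξ) = b)
    (hF5' : ∀ x : E4, R ≤ ‖Q x‖ → ∃ ξ, F (Q x) ξ = x) :
    ∃ β : E4 → ℂ × ℂ, ContDiff ℝ ∞ β ∧ (∀ p : ℂ × ℂ, β (F p.1 p.2) = p) ∧
      (∀ x, F (β x).1 (β x).2 = x) ∧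
      (∀ x, Function.Surjective (fderiv ℝ (fun y => (β y).1) x)) ∧
      (∀ x v, fderiv ℝ (fun y => (β y).1) x v = 0 ↔
        ∃ ζ : ℂ, v = fderiv ℝ (F (β x).1) (β x).2 ζ) ∧
      (∀ x v, fderiv ℝ (fun y => (β y).1) x v = 0 →
        fderiv ℝ (fun y => (β y).1) x (J x v) = 0) ∧
      (∀ x, R ≤ ‖Q x‖ → (β x).1 = Q x) ∧
      (∀ x, ‖Q x‖ < R → ‖(β x).1‖ < R) := by
  obtain ⟨β, hβ, hl, hr⟩ := AnchorOfPencil.exists_contDiff_inverse hF1 hF2 hF3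
  -- `hl : β (F b ξ) = (b, ξ)` and `hr : F (β x).1 (β x).2 = x`, in applied form
  have hl' : ∀ b ξ : ℂ, β (F b ξ) = (b, ξ) := fun b ξ => hl (b, ξ)
  have hr' : ∀ x, F (β x).1 (β x).2 = x := hr
  have hΦd : Differentiable ℝ (fun p : ℂ × ℂ => F p.1 p.2) := hF1.differentiable (by simp)
  have hβd : Differentiable ℝ β := hβ.differentiable (by simp)
  -- the chain rule on `β ∘ Φ = id` (at `p = β x`) and on `Φ ∘ β = id`
  have h1 : ∀ x, (fderiv ℝ β x).comp (fderiv ℝ (fun p : ℂ × ℂ => F p.1 p.2) (β x)) =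
      ContinuousLinearMap.id ℝ (ℂ × ℂ) := by
    intro x
    have h := AnchorOfPencil.fderiv_comp_fderiv_eq_id hΦd hβd hl (β x)
    rwa [hr x] at h
  have h2 : ∀ x, (fderiv ℝ (fun p : ℂ × ℂ => F p.1 p.2) (β x)).comp (fderiv ℝ β x) =
      ContinuousLinearMap.id ℝ E4 :=
    fun x => AnchorOfPencil.fderiv_comp_fderiv_eq_id hβd hΦd hr x
  -- the differential of the anchor map is `fst ∘ dβ`
  have hfst : ∀ x, fderiv ℝ (fun y => (β y).1) x =
      (ContinuousLinearMap.fst ℝ ℂ ℂ).comp (fderiv ℝ β x) :=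
    fun x => fderiv.fst (hβd x)
  -- the differential of a slice `F b = Φ ∘ (b, ·)` is `dΦ ∘ inr`
  have hsl : ∀ x, fderiv ℝ (F (β x).1) (β x).2 =
      (fderiv ℝ (fun p : ℂ × ℂ => F p.1 p.2) (β x)).comp (ContinuousLinearMap.inr ℝ ℂ ℂ) := by
    intro x
    have h : HasFDerivAt ((fun p : ℂ × ℂ => F p.1 p.2) ∘ fun ξ : ℂ => ((β x).1, ξ))
        ((fderiv ℝ (fun p : ℂ × ℂ => F p.1 p.2) (β x)).comp (ContinuousLinearMap.inr ℝ ℂ ℂ))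
        (β x).2 :=
      (hΦd (β x)).hasFDerivAt.comp (β x).2 (hasFDerivAt_prodMk_right (β x).1 (β x).2)
    exact h.fderiv
  -- the kernel of the anchor differential is the tangent plane of the member
  have hker : ∀ x v, fderiv ℝ (fun y => (β y).1) x v = 0 ↔
      ∃ ζ : ℂ, v = fderiv ℝ (F (β x).1) (β x).2 ζ := by
    intro x v
    rw [hfst x, hsl x]
    constructor
    · intro hv
      have hv' : (fderiv ℝ β x v).1 = 0 := by simpa using hv
      refine ⟨(fderiv ℝ β x v).2, ?_⟩
      have e1 : fderiv ℝ β x v = (0, (fderiv ℝ β x v).2) := Prod.ext hv' rfl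
      have e2 := DFunLike.congr_fun (h2 x) v
      rw [ContinuousLinearMap.comp_apply, ContinuousLinearMap.id_apply] at e2
      rw [ContinuousLinearMap.comp_apply, ContinuousLinearMap.inr_apply, ← e1]
      exact e2.symm
    · rintro ⟨ζ, rfl⟩
      have e := congrArg Prod.fst (DFunLike.congr_fun (h1 x) (0, ζ))
      simpa using e
  refine ⟨β, hβ, hl, hr', ?_, hker, ?_, ?_, ?_⟩
  · -- submersion: `dβ` is onto (right inverse `dΦ`), and so is `fst`
    intro x w
    refine ⟨fderiv ℝ (fun p : ℂ × ℂ => F p.1 p.2) (β x) (w, 0), ?_⟩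
    have e := congrArg Prod.fst (DFunLike.congr_fun (h1 x) (w, 0))
    rw [hfst x]
    simpa using e
  · -- `J`-invariance of the kernel: the slices are `J`-holomorphic
    intro x v hv
    obtain ⟨ζ, hζ⟩ := (hker x v).1 hv
    refine (hker x (J x v)).2 ⟨Complex.I * ζ, ?_⟩
    rw [(isJHolomorphicFlat_iff.1 (hF4 (β x).1)) (β x).2 ζ, ← hζ, hr' x]
  · -- honesty far out
    intro x hx
    obtain ⟨ξ, hξ⟩ := hF5' x hx
    have h : β (F (Q x) ξ) = (Q x, ξ) := hl' (Q x) ξ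
    rw [hξ] at h
    rw [h]
  · -- slab confinement
    intro x hx
    by_contra h
    have hb : Q (F (β x).1 (β x).2) = (β x).1 := hF5 (β x).1 (not_lt.1 h) (β x).2
    rw [hr' x] at hb
    rw [hb] at hx
    exact h hx

end Summit.SmoothPoincare4.SmoothPoincare4.Cruxes.TameOrBrodyR4.Sketch
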